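import Summits.QuantumFields.YangMills.Theorems.HypercubicLimit.Negative.OneFieldReduction
import Summits.QuantumFields.YangMills.Theses.MirrorModularBoosts

/-!
# `SpeciesProjectionPlanar` — species bookkeeping (item stmt-QuantumFields-9668)

Closes the support item `stmt-QuantumFields-9668`, the decl
`Summit.QuantumFields.YangMills.Theses.PencilRigidity.SpeciesProjectionPlanar` (shared verbatim with
route MirrorModularBoosts, whose copy is closed by the same argument, `…_mirrorModularBoosts`).

Statement.  If `G` admits `(r, sch, S)` with the `HypercubicLimit` clauses `W r sch S` and planar-rotation
invariance (determinant-one isometries fixing `e₂, e₃`) of the CURVATURE strings `S n (r.curvature ⋯ r.curvature)`,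
then `G` admits `(r, sch', S')` with `W r sch' S'` and planar-rotation invariance of EVERY species string.

Proof (the planner's construction, with the tree's one-field reduction of `HypercubicLimit`,
`Theorems/HypercubicLimit/Negative/{ExtendByZero,OneFieldReduction}.lean`):
`sch' := onlySpecies sch r.curvature` (every species other than the curvature renormalised to `c_s ≡ 0`),
`S' := extendByZero r.curvature (restrictTo r.curvature S)` (`S' n k = S n (r.curvature ⋯)` on the constant
curvature string, `0` on every other string).  `W r sch' S'` is `clauses_of_clauses₁ ∘ clauses₁_of_clauses`
(lattice correlators with a zero factor vanish; E2 of `S'` is E2 of `S` on the all-curvature sub-list;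
`HasLatticeMassGap` sees `(a_k, β_k, L_k)` only), and planar invariance of `S' n k` is the hypothesis on the
constant curvature string and `0 = 0` on the others. [folklore]
-/

noncomputable section

open scoped SchwartzMap
open MeasureTheory Filter Topology
open Literature.MathematicalPhysics.AQFT Literature.MathematicalPhysics.QuantumLattice
open Literature.MathematicalPhysics.QuantumFieldTheory
open Summit.QuantumFields.YangMills.Theorems.HypercubicLimit.Negative

namespace Summit.QuantumFields.YangMills.Theorems

/-- **Species bookkeeping (planar form).** From a witness `(r, sch, S)` of the `HypercubicLimit` clauses whose
curvature strings are invariant under the determinant-one isometries fixing `e₂, e₃`, the witness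
`(r, onlySpecies sch r.curvature, extendByZero r.curvature (restrictTo r.curvature S))` has the same clauses and
ALL its species strings planar-rotation invariant.  Closes item stmt-QuantumFields-9668 for route
PencilRigidity. [folklore] -/
theorem SpeciesProjectionPlanar_proof :
    Summit.QuantumFields.YangMills.Theses.PencilRigidity.SpeciesProjectionPlanar := by
  unfold Summit.QuantumFields.YangMills.Theses.PencilRigidity.SpeciesProjectionPlanar
  intro E G _ _ _ _ hG W
  rintro ⟨r, sch, S, hW, hplanar⟩
  letI : MeasurableSpace G := borel G
  haveI : BorelSpace G := ⟨rfl⟩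
  refine ⟨r, onlySpecies sch r.curvature, extendByZero r.curvature (restrictTo r.curvature S),
    clauses_of_clauses₁ (clauses₁_of_clauses hW), ?_⟩
  intro R hdet h2 h3 n k F hF
  by_cases hk : ∀ i, k i = r.curvature
  · rw [extendByZero_of_all r.curvature (restrictTo r.curvature S) hk]
    exact hplanar R hdet h2 h3 n F hF
  · rw [extendByZero_of_not_all r.curvature (restrictTo r.curvature S) hk]
    rfl

/-- The same decl in route MirrorModularBoosts (`SpeciesProjectionPlanar` is SHARED VERBATIM between the two
routes; item stmt-QuantumFields-9668 is wanted by both). [folklore] -/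
theorem SpeciesProjectionPlanar_proof_mirrorModularBoosts :
    Summit.QuantumFields.YangMills.Theses.MirrorModularBoosts.SpeciesProjectionPlanar := by
  unfold Summit.QuantumFields.YangMills.Theses.MirrorModularBoosts.SpeciesProjectionPlanar
  exact SpeciesProjectionPlanar_proof

end Summit.QuantumFields.YangMills.Theorems

end
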